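import Summits.RiemannHypothesis.RiemannHypothesis.Theorems.LagariasThetaContractive
import Literature.Analysis.Complex.HadamardMinimumModulus
import HarnessLib

/-!
# The Lagarias zero-free door in programme-standard form: `Titchmarsh1939_thm_8_711 → MinModulusCircles`
# (Part F of the dbr-neg g6 kernel #2; RH-EQUIVALENT door CONDITIONAL on ONE printed theorem, named fact as hypothesis)

Cell rh-split, seat rh-split-dbr-neg g6 (brief sha16 f79c5f09d8bcb036), card `run/shared/lean/pub/rh-split/cards/SPLIT-dbr-neg.md` §14;
Part F of `HOME/rh-split-dbr-neg/SketchG6b.lean` (sha16 8b5fe01427815710, ll. 352–458; referee rh-split-ref g3 REPLAY PASS + LABELS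
2026-08-27T05:26:37Z; lead rh-split-lead g3 RULING #23 (vi-F)), filed by rh-split-typer-2 g4 on top of
`Theorems/LagariasThetaContractive.lean` (Parts C–D) and the Literature named fact
`Literature.Analysis.Complex.Titchmarsh1939_thm_8_711` (`Literature/Analysis/Complex/HadamardMinimumModulus.lean`, Part E:
Hadamard's minimum-modulus theorem, Titchmarsh *Theory of Functions* §8.711 = Boas *Entire Functions* Thm. 2.7.4, typed verbatim).
Zero definitions; the five decl blocks are byte-verbatim (namespace `…Theorems.LagariasZeroFreeDoorHadamard`, opening
`…Theorems.LagariasZeroFreeDoor`, `…LagariasZeroFreeDoorStrip`, `…LagariasThetaContractive`).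

* `mul_log_le_rpow_add` — pure real analysis: `A (X+2) log (X+3) ≤ X^{1+δ} + K(A, δ)`;
* `lagariasE_norm_le_exp_rpow` — RH-FREE: `E_ξ` has order `≤ 1` in the named fact's currency
  (`∀ δ > 0, ∃ C, ‖E_ξ z‖ ≤ C·exp(‖z‖^{1+δ})`, from `exists_norm_riemannXi_and_deriv_le`);
* `minModulusCircles_of_hadamard : Titchmarsh1939_thm_8_711 → MinModulusCircles` — the tree's typed input of the door
  (`Theorems/LagariasZeroFreeDoor.lean`) is an INSTANCE of the printed theorem (`f = E_ξ`, `ρ = 1`, `E_ξ(i) ≠ 0`);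
* `riemannHypothesis_iff_lagariasE_zeroFree (h : Titchmarsh1939_thm_8_711) : RH ↔ ∀ z, 0 < Im z → E_ξ z ≠ 0` — the Lagarias
  ZERO-FREE DOOR, RH-EQUIVALENT, kernel modulo exactly ONE named PRINTED theorem;
* `norm_lagariasTheta_mul_le_one_of_hadamard` — the multiplier bound of Part D in the same standard form.

LABELS (referee g3 05:26:37Z): `mul_log_le_rpow_add`, `lagariasE_norm_le_exp_rpow` RH-FREE kernel theorems;
`minModulusCircles_of_hadamard` RH-FREE kernel implication; `riemannHypothesis_iff_lagariasE_zeroFree` RH-EQUIVALENT door,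
CONDITIONAL on the named printed fact (it certifies nothing about RH); `norm_lagariasTheta_mul_le_one_of_hadamard` likewise
conditional.  The discharge `Literature.Analysis.Complex.Titchmarsh1939_thm_8_711_holds` (typer-2 g4,
`Literature/Analysis/Complex/HadamardMinimumModulusProofs.lean`) makes the door unconditional; that corollary is filed separately.
Nothing here is a claim about the truth of RH.
-/

noncomputable section

-- D-0017: `Summit.<S>.<S>.…` is the designed namespace of a single-problem summit.
set_option linter.dupNamespace false

open Set Filter Metric Complex Bornology Topology
open scoped ComplexConjugate
open Literature.NumberTheory.LFunctions Literature.Analysis.DeBrangesSpaces Literature.Analysis.Complex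
open Summit.RiemannHypothesis.RiemannHypothesis.Theorems.LagariasZeroFreeDoor
open Summit.RiemannHypothesis.RiemannHypothesis.Theorems.LagariasZeroFreeDoorStrip
open Summit.RiemannHypothesis.RiemannHypothesis.Theorems.LagariasThetaContractive

namespace Summit.RiemannHypothesis.RiemannHypothesis.Theorems.LagariasZeroFreeDoorHadamard

/-- Pure real analysis (RH-FREE): `A (X+2) log (X+3) ≤ X^{1+δ} + K(A, δ)` for `X ≥ 0`
(`log x ≤ x^{δ/2}/(δ/2)` and a two-regime split at `X₀ = max 3 (c^{2/δ})`). -/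
theorem mul_log_le_rpow_add {A δ : ℝ} (hA : 0 ≤ A) (hδ : 0 < δ) :
    ∃ K : ℝ, 0 ≤ K ∧ ∀ X : ℝ, 0 ≤ X → A * (X + 2) * Real.log (X + 3) ≤ X ^ (1 + δ) + K := by
  have hδ0 : δ ≠ 0 := hδ.ne'
  set c : ℝ := 2 * A / δ * (2 : ℝ) ^ (1 + δ / 2) with hc
  have hc0 : 0 ≤ c := by positivity
  set X₀ : ℝ := max 3 (c ^ (2 / δ)) with hX₀
  have hX₀3 : 3 ≤ X₀ := le_max_left _ _
  set K : ℝ := 2 * A / δ * (X₀ + 3) ^ (1 + δ / 2) with hK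
  have hK0 : 0 ≤ K := by positivity
  refine ⟨K, hK0, fun X hX => ?_⟩
  have hX3 : 0 < X + 3 := by linarith
  have hlog : Real.log (X + 3) ≤ (X + 3) ^ (δ / 2) / (δ / 2) :=
    Real.log_le_rpow_div hX3.le (by positivity)
  have hlog0 : 0 ≤ Real.log (X + 3) := Real.log_nonneg (by linarith)
  have h1 : A * (X + 2) * Real.log (X + 3) ≤ 2 * A / δ * (X + 3) ^ (1 + δ / 2) := by
    calc A * (X + 2) * Real.log (X + 3) ≤ A * (X + 3) * ((X + 3) ^ (δ / 2) / (δ / 2)) :=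
          mul_le_mul (mul_le_mul_of_nonneg_left (by linarith) hA) hlog hlog0 (by positivity)
      _ = 2 * A / δ * ((X + 3) ^ (1 : ℝ) * (X + 3) ^ (δ / 2)) := by
          rw [Real.rpow_one]; field_simp
      _ = 2 * A / δ * (X + 3) ^ (1 + δ / 2) := by rw [← Real.rpow_add hX3]
  rcases le_or_gt X₀ X with hbig | hsmall
  · have hX0 : 0 < X := by linarith
    have h2X : X + 3 ≤ 2 * X := by linarith
    have h2 : (X + 3) ^ (1 + δ / 2) ≤ (2 : ℝ) ^ (1 + δ / 2) * X ^ (1 + δ / 2) := by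
      rw [← Real.mul_rpow (by norm_num) hX0.le]
      exact Real.rpow_le_rpow hX3.le h2X (by positivity)
    have h3 : c ≤ X ^ (δ / 2) := by
      have hcX : c ^ (2 / δ) ≤ X := le_trans (le_max_right _ _) hbig
      calc c = (c ^ (2 / δ)) ^ (δ / 2) := by
            rw [← Real.rpow_mul hc0, show (2 : ℝ) / δ * (δ / 2) = 1 by field_simp, Real.rpow_one]
        _ ≤ X ^ (δ / 2) := Real.rpow_le_rpow (by positivity) hcX (by positivity)
    calc A * (X + 2) * Real.log (X + 3) ≤ 2 * A / δ * (X + 3) ^ (1 + δ / 2) := h1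
      _ ≤ 2 * A / δ * ((2 : ℝ) ^ (1 + δ / 2) * X ^ (1 + δ / 2)) :=
          mul_le_mul_of_nonneg_left h2 (by positivity)
      _ = c * X ^ (1 + δ / 2) := by rw [hc]; ring
      _ ≤ X ^ (δ / 2) * X ^ (1 + δ / 2) := mul_le_mul_of_nonneg_right h3 (by positivity)
      _ = X ^ (1 + δ) := by rw [← Real.rpow_add hX0]; congr 1; ring
      _ ≤ X ^ (1 + δ) + K := le_add_of_nonneg_right hK0
  · have h2 : (X + 3) ^ (1 + δ / 2) ≤ (X₀ + 3) ^ (1 + δ / 2) :=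
      Real.rpow_le_rpow hX3.le (by linarith) (by positivity)
    calc A * (X + 2) * Real.log (X + 3) ≤ 2 * A / δ * (X + 3) ^ (1 + δ / 2) := h1
      _ ≤ K := by rw [hK]; exact mul_le_mul_of_nonneg_left h2 (by positivity)
      _ ≤ X ^ (1 + δ) + K := le_add_of_nonneg_left (by positivity)

/-- RH-FREE.  `E_ξ` has order `≤ 1` in the standard currency: `∀ δ > 0, ∃ C, ‖E_ξ(z)‖ ≤ C·exp(‖z‖^{1+δ})`
(from the tree's `exists_norm_riemannXi_and_deriv_le`, Titchmarsh (2.12.3) + Cauchy, and `mul_log_le_rpow_add`). -/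
theorem lagariasE_norm_le_exp_rpow :
    ∀ δ : ℝ, 0 < δ → ∃ C : ℝ, ∀ z : ℂ, ‖lagariasE z‖ ≤ C * Real.exp (‖z‖ ^ ((1 : ℝ) + δ)) := by
  intro δ hδ
  obtain ⟨A, C, hA, hC, h⟩ := exists_norm_riemannXi_and_deriv_le
  obtain ⟨K, -, hK⟩ := mul_log_le_rpow_add hA hδ
  refine ⟨2 * C * Real.exp K, fun z => ?_⟩
  set s : ℂ := 1 / 2 - I * z with hs
  set N : ℝ := ‖s‖ with hN
  have hN0 : 0 ≤ N := norm_nonneg _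
  have hz0 : 0 ≤ ‖z‖ := norm_nonneg _
  have hNz : N ≤ ‖z‖ + 1 / 2 := by
    rw [hN, hs]
    calc ‖(1 : ℂ) / 2 - I * z‖ ≤ ‖(1 : ℂ) / 2‖ + ‖I * z‖ := norm_sub_le _ _
      _ = ‖z‖ + 1 / 2 := by
          rw [norm_mul, Complex.norm_I, one_mul]
          have : ‖(1 : ℂ) / 2‖ = 1 / 2 := by
            rw [norm_div, norm_one, Complex.norm_two]
          rw [this]; ring
  have hexp : A * (N + 1) * Real.log (2 + N) ≤ ‖z‖ ^ ((1 : ℝ) + δ) + K := by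
    have h1 : A * (N + 1) * Real.log (2 + N) ≤ A * (‖z‖ + 2) * Real.log (‖z‖ + 3) :=
      mul_le_mul (mul_le_mul_of_nonneg_left (by linarith) hA)
        (Real.log_le_log (by linarith) (by linarith)) (Real.log_nonneg (by linarith)) (by positivity)
    exact h1.trans (hK ‖z‖ hz0)
  have hE : ‖lagariasE z‖ ≤ 2 * C * Real.exp (A * (N + 1) * Real.log (2 + N)) := by
    have h1 := (h s).1
    have h2 := (h s).2
    calc ‖lagariasE z‖ = ‖riemannXi s + deriv riemannXi s‖ := rfl
      _ ≤ ‖riemannXi s‖ + ‖deriv riemannXi s‖ := norm_add_le _ _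
      _ ≤ 2 * C * Real.exp (A * (N + 1) * Real.log (2 + N)) := by linarith
  calc ‖lagariasE z‖ ≤ 2 * C * Real.exp (A * (N + 1) * Real.log (2 + N)) := hE
    _ ≤ 2 * C * Real.exp (‖z‖ ^ ((1 : ℝ) + δ) + K) :=
        mul_le_mul_of_nonneg_left (Real.exp_le_exp.2 hexp) (by positivity)
    _ = 2 * C * Real.exp K * Real.exp (‖z‖ ^ ((1 : ℝ) + δ)) := by rw [Real.exp_add]; ring

/-- **RH-FREE bookkeeping.  The tree's typed input `MinModulusCircles` is an INSTANCE of the printed theorem**: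
`Titchmarsh1939_thm_8_711 → MinModulusCircles` (with `f = E_ξ`, `ρ = 1`, `E_ξ(i) ≠ 0`). -/
theorem minModulusCircles_of_hadamard (h : Titchmarsh1939_thm_8_711) : MinModulusCircles := by
  intro ε hε R
  have hne : ∃ z : ℂ, lagariasE z ≠ 0 := ⟨I, (cayleyHalfPlaneControl I (by norm_num)).1⟩
  obtain ⟨r, hr, hcirc⟩ :=
    h lagariasE 1 zero_le_one differentiable_lagariasE hne lagariasE_norm_le_exp_rpow ε hε R
  exact ⟨r, hr.le, fun z hz => (hcirc z hz).le⟩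

/-- **The Lagarias zero-free door in programme-standard form** (RH-EQUIVALENT·CONDITIONAL-on-a-PRINTED-THEOREM, the
named fact as hypothesis; no cell-typed input left): `Titchmarsh1939_thm_8_711 → (RH ↔ E_ξ zero-free on ℂ₊)`.
It certifies nothing about RH. -/
theorem riemannHypothesis_iff_lagariasE_zeroFree (h : Titchmarsh1939_thm_8_711) :
    RiemannHypothesis ↔ ∀ z : ℂ, 0 < z.im → lagariasE z ≠ 0 :=
  zeroFreeDoorIff_of_minModulusCircles (minModulusCircles_of_hadamard h)

/-- Same standard form for the multiplier bound of Part D (RH-FREE·CONDITIONAL-on-a-PRINTED-THEOREM): for any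
`|b| ≤ 1` on the closed upper half-plane (continuous at real points) and any holomorphic extension `S` of `Θ_ξ·b`
to the strip, `|Θ_ξ·b| ≤ 1` on `ℂ₊` off `Z(E_ξ)`. -/
theorem norm_lagariasTheta_mul_le_one_of_hadamard (h : Titchmarsh1939_thm_8_711) {b S : ℂ → ℂ}
    (hS : DiffContOnCl ℂ S (im ⁻¹' Ioo 0 (1 / 2)))
    (hSb : ∀ z : ℂ, 0 ≤ z.im → lagariasE z ≠ 0 → S z = lagariasTheta z * b z)
    (hb : ∀ z : ℂ, 0 ≤ z.im → ‖b z‖ ≤ 1) (hbc : ∀ x : ℝ, ContinuousAt b x)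
    {z : ℂ} (hz : 0 < z.im) (hE : lagariasE z ≠ 0) : ‖lagariasTheta z * b z‖ ≤ 1 :=
  norm_lagariasTheta_mul_le_one (minModulusCircles_of_hadamard h) hS hSb hb hbc hz hE

end Summit.RiemannHypothesis.RiemannHypothesis.Theorems.LagariasZeroFreeDoorHadamard

end
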